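import Summits.BirchSwinnertonDyer.BirchSwinnertonDyer.Theorems.SchneiderFreeAdditiveX3JointLowerTransport
import Summits.BirchSwinnertonDyer.Rank1Residual.Additive.RamifiedTwistTamagawa
import Summits.BirchSwinnertonDyer.Rank1Residual.X11b.CastellaErratumTwistUnits
import Literature.NumberTheory.EllipticCurves.PAdicGrossZagierConstantTermProofs
import HarnessLib

/-!
# Route `SchneiderFreeAdditiveX3` (rung K1 door), item `JointLowerManin` (stmt-BirchSwinnertonDyer-19180):
# Tamagawa and twist-unit EQUALITIES along the Heegner twist at EVERY odd prime (no `p ∤ d_K`)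

Seat `bsd-schneider-door-c5` (cell `bsd-schneider-ideate`), gen 3 — the arithmetic behind the three
REGISTERED BC3 stubs of the item (§3 here: `stub_tamagawa_twist_heegner_odd` verbatim; the other two in
`…JointLowerManinStubs.lean`). Gen 0 closed the item
through the INEQUALITIES `ord_p ∏c(E) ≤ ord_p ∏c(E^{d_K})` (`padicValNat_tamagawaProduct_le_twist_of_heegner`)
and `0 ≤ v_p(u)` (`padicValRat_u_nonneg_of_twist_minimal_of_odd`); here are the EQUALITIES, at every odd
prime `p`, with NO hypothesis `p ∤ d_K`:

* §1 `padicValNat_localTamagawaNumber_twist_eq_of_heegner_odd` /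
  `padicValNat_tamagawaProduct_twist_eq_of_heegner_odd` — `ord_p c_ℓ(E^{d_K}) = ord_p c_ℓ(E)` at every
  prime `ℓ`, and `ord_p ∏_ℓ c_ℓ(E^{d_K}) = ord_p ∏_ℓ c_ℓ(E)`, for `K` imaginary quadratic with odd `d_K`
  satisfying the Heegner hypothesis for `N_E`, ANY equation `Wd = Cd • E^{(d_K)}` and every odd `p`. The
  tree's `X2.padicValNat_tamagawaProduct_twist_of_heegner_of_odd` carries `p ∤ d_K`, used only to push a
  prime `ℓ ∣ d_K` to `ℓ ≥ 5` in the type-`I₀*` branch; additive-p4's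
  `Additive.tamagawaNumberAt_twist_of_semistable_mem` (Tate's algorithm Steps 6–7 in the kernel:
  `c ∈ {1, 2, 4}` at the ramified twist of a good ODD place, `ℓ = 3` included) removes it.
* §2 `padicValRat_u_eq_zero_of_twist_minimal_of_good_of_odd` /
  `padicValRat_u_eq_zero_of_twist_minimal_of_heegner_odd` — `v_p(u(Cd)) = 0` for a globally minimal
  model `Wd = Cd • E^{(d)}` at every odd `p`: at a good prime `p` with `p² ∤ d` because
  `0 ≤ v_p Δ(Wd) = −12 v_p(u) + 6 v_p(d) + v_p Δ_min(E) ≤ −12 v_p(u) + 6` and `0 ≤ v_p(u)`; at `p ∣ N_E`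
  because `p` splits in the Heegner field (tree `X11b.padicValRat_u_eq_zero_of_twist_minimal_of_splitsIn`).

Elementary local arithmetic; theorems only; nothing asserted; the item is already closed. HONEST FRAMING:
BSD is not advanced by any of this.

References: [JetchevSkinnerWan2017] §7.3.1 (eq:tamK), §7.4.1 (arXiv:1512.06894 pp. 29–31);
[SilvermanATAEC1994] IV.9.4 Steps 6–7, Table 4.1, Cor. IV.9.2(d); [SilvermanAEC2009] VII.1 Prop. 1.3 and
Remark 1.1, VII.5 Prop. 5.1, X.5 Cor. 5.4.
-/

set_option autoImplicit false
-- project-wide summit namespace `Summit.BirchSwinnertonDyer.BirchSwinnertonDyer.…` (summit = problem) trips the linter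
set_option linter.dupNamespace false

noncomputable section

open scoped Classical

open IsDedekindDomain NumberField Rat.HeightOneSpectrum WeierstrassCurve
  Literature.NumberTheory.EllipticCurves Literature.NumberTheory.EllipticCurves.ModularForms
  Literature.NumberTheory.QuadraticFields Literature.NumberTheory.EllipticCurves.Rank1Residual
  Literature.NumberTheory.EllipticCurves.Rank1Residual.Typed
  Summit.BirchSwinnertonDyer.Rank1Residual

namespace Summit.BirchSwinnertonDyer.BirchSwinnertonDyer.Theorems.SchneiderFree

/-! ### §1 `ord_p c_ℓ(E^{d_K}) = ord_p c_ℓ(E)` on a Heegner field, every odd `p` (no `p ∤ d_K`) -/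

/-- **`ord_p c_ℓ(E^{(d_K)}) = ord_p c_ℓ(E)` at every prime `ℓ`, for EVERY odd prime `p`** — `K`
imaginary quadratic with `d_K` odd in which every prime of the conductor `N` of the globally minimal
`W` splits, `Wd = Cd • W^{(d_K)}` any equation of the twist. Cases: `ℓ ∣ N` — `d_K ∈ (ℚ_ℓ^×)²`, the
two curves are `ℚ_ℓ`-isomorphic; `ℓ ∤ N` (`c_ℓ(W) = 1`) and `ℓ ∣ d_K` — `ℓ` odd, `ℓ ∥ d_K`
(`d_K` squarefree), Kodaira type `I₀*`, `c_ℓ(Wd) ∈ {1, 2, 4}` (`Additive.tamagawaNumberAt_twist_of_semistable_mem`,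
valid at `ℓ = 3`), a `p`-unit; `ℓ ∤ N d_K` — `d_K ≡ 1 (mod 4)`, good reduction preserved,
`c_ℓ(Wd) = 1`. The tree's `X2.padicValNat_localTamagawaNumber_twist_eq_of_odd` is this under the
extra binder `p ∤ d_K`. [cite: JetchevSkinnerWan2017, §7.3.1 (eq:tamK) (arXiv:1512.06894 p. 29)]
[cite: SilvermanATAEC1994, IV.9.4 Steps 6–7 and Table 4.1 (PDF pp. 365–366)] -/
theorem padicValNat_localTamagawaNumber_twist_eq_of_heegner_odd (W : WeierstrassCurve ℚ)
    [W.IsElliptic] [W.IsGloballyMinimal] (p : ℕ) [Fact p.Prime] (hp2 : p ≠ 2) (K : Type) [Field K]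
    [NumberField K] (hK : IsImaginaryQuadratic K) (hodd : Odd (NumberField.discr K))
    (hH : SatisfiesHeegnerHypothesis (W.conductorNorm ℤ) K)
    {Wd : WeierstrassCurve ℚ} [Wd.IsElliptic] (Cd : VariableChange ℚ)
    (hWd : Cd • W.quadraticTwist (NumberField.discr K : ℚ) = Wd) (ℓ : ℕ) [Fact ℓ.Prime] :
    padicValNat p ((Wd.baseChange ℚ_[ℓ]).localTamagawaNumber ℤ_[ℓ]) =
      padicValNat p ((W.baseChange ℚ_[ℓ]).localTamagawaNumber ℤ_[ℓ]) := by
  have hpP : p.Prime := Fact.out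
  have hℓP : ℓ.Prime := Fact.out
  set d : ℤ := NumberField.discr K with hd_def
  have hdZ : d ≠ 0 := NumberField.discr_ne_zero K
  have hD0 : (d : ℚ) ≠ 0 := by exact_mod_cast hdZ
  haveI : (W.baseChange ℚ_[ℓ]).IsElliptic :=
    inferInstanceAs (W.map (algebraMap ℚ ℚ_[ℓ])).IsElliptic
  haveI : (Wd.baseChange ℚ_[ℓ]).IsElliptic :=
    inferInstanceAs (Wd.map (algebraMap ℚ ℚ_[ℓ])).IsElliptic
  haveI : (W.quadraticTwist (d : ℚ)).IsElliptic := W.isElliptic_quadraticTwist hD0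
  by_cases hℓN : ℓ ∣ W.conductorNorm ℤ
  · -- `ℓ ∣ N`: `d_K` is a square in `ℚ_ℓ`, the two curves are `ℚ_ℓ`-isomorphic
    obtain ⟨θ, hθ⟩ := X11b.isSquare_discr_padic_of_heegner K hK hH ℓ hℓN
    have hθ0 : θ ≠ 0 := by
      rintro rfl
      exact (map_ne_zero (algebraMap ℚ ℚ_[ℓ])).mpr hD0 (hθ.trans (mul_zero 0))
    obtain ⟨C, hC⟩ := (W.baseChange ℚ_[ℓ]).exists_variableChange_smul_eq_quadraticTwist_sq hθ0
    have h1 : (W.quadraticTwist (d : ℚ)).baseChange ℚ_[ℓ] = C • W.baseChange ℚ_[ℓ] := by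
      rw [hC, baseChange, baseChange, map_quadraticTwist, hθ, sq]
    have hYX : Wd.baseChange ℚ_[ℓ] = (Cd.map (algebraMap ℚ ℚ_[ℓ]) * C) • W.baseChange ℚ_[ℓ] := by
      rw [← hWd, WeierstrassCurve.VariableChange.baseChange_smul_eq (W.quadraticTwist (d : ℚ)) Cd ℚ_[ℓ],
        h1, mul_smul]
    rw [hYX, localTamagawaNumber_variableChange_holds ℤ_[ℓ] (W.baseChange ℚ_[ℓ])
      (Cd.map (algebraMap ℚ ℚ_[ℓ]) * C)]
  · -- `ℓ ∤ N`: `W` is good at `ℓ`, `c_ℓ(W) = 1`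
    have hgood : W.HasGoodReductionAtPrime ℓ := by
      by_contra h
      exact hℓN ((W.dvd_conductorNorm_iff_not_hasGoodReductionAtPrime ℓ).mpr h)
    have hcW : (W.baseChange ℚ_[ℓ]).localTamagawaNumber ℤ_[ℓ] = 1 := by
      haveI : ((W.baseChange ℚ_[ℓ]).minimal ℤ_[ℓ]).HasGoodReduction ℤ_[ℓ] := hgood
      exact localTamagawaNumber_eq_one_of_hasGoodReduction_holds ℤ_[ℓ] _
    rw [hcW, padicValNat_one_right]
    by_cases hℓd : (ℓ : ℤ) ∣ d
    · -- `ℓ ∣ d_K`: `ℓ` odd, `ℓ ∥ d_K`, Kodaira type `I₀*`, `c ∈ {1, 2, 4}` — ANY odd `ℓ`, `ℓ = 3` included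
      have hℓ2 : ℓ ≠ 2 := by
        rintro rfl
        obtain ⟨m, hm⟩ := hodd
        omega
      have hsq : ¬ (ℓ : ℤ) ^ 2 ∣ d := by
        intro h
        have hsf := squarefree_discr_of_odd hK hodd
        have hunit := hsf (ℓ : ℤ) (by rw [← sq]; exact h)
        rw [Int.isUnit_iff_natAbs_eq, Int.natAbs_natCast] at hunit
        exact hℓP.one_lt.ne' hunit
      obtain ⟨v, hv⟩ : ∃ v : HeightOneSpectrum (𝓞 ℚ), ((primesEquiv v : ℕ)) = ℓ :=
        ⟨primesEquiv.symm ⟨ℓ, hℓP⟩, by rw [Equiv.apply_symm_apply]⟩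
      have hgood' : W.HasGoodReductionAt v := by
        rw [← hasGoodReductionAtPrime_iff_hasGoodReductionAt_ringOfIntegers v W]
        convert hgood
      have hmem := Additive.tamagawaNumberAt_twist_of_semistable_mem v W (by rw [hv]; exact hℓ2) hdZ
        (by rw [hv]; exact hℓd) (by rw [hv]; exact hsq) (Or.inl hgood') Cd hWd
      rw [tamagawaNumberAt_def, ← localTamagawaNumber_padic_eq_holds Wd v ℓ hv] at hmem
      have hp2' : ¬ p ∣ 2 := fun h ↦ hp2 ((Nat.prime_dvd_prime_iff_eq hpP Nat.prime_two).mp h)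
      have hp4 : ¬ p ∣ 4 := fun h ↦
        hp2' (((Nat.Prime.dvd_mul hpP).mp (show p ∣ 2 * 2 by norm_num; exact h)).elim id id)
      rcases hmem with h | h | h <;> rw [h]
      · simp
      · exact padicValNat.eq_zero_of_not_dvd hp2'
      · exact padicValNat.eq_zero_of_not_dvd hp4
    · -- `ℓ ∤ N d_K`: unramified twist, good reduction preserved, `c_ℓ(Wd) = 1`
      have h4 : d = 4 * (d / 4) + 1 := by
        rcases Quadratic.isFundamentalDiscriminant_discr (K := K) hK.1 with ⟨h1, -, -⟩ | ⟨h4, -, -⟩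
        · omega
        · exfalso
          obtain ⟨k, hk⟩ := h4
          obtain ⟨m, hm⟩ := hodd
          omega
      rw [X2.localTamagawaNumber_twist_of_not_dvd W ℓ h4 hℓd hgood Cd hWd, padicValNat_one_right]

/-- `ord_p` of a finite product of non-zero naturals is the sum of the `ord_p`. [folklore] -/
private theorem padicValNat_finset_prod_stubs (p : ℕ) [Fact p.Prime] {ι : Type*} (s : Finset ι)
    (f : ι → ℕ) (hf : ∀ i ∈ s, f i ≠ 0) :
    padicValNat p (∏ i ∈ s, f i) = ∑ i ∈ s, padicValNat p (f i) := by
  induction s using Finset.induction_on with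
  | empty => simp
  | insert a s ha ih =>
    rw [Finset.prod_insert ha, Finset.sum_insert ha,
      padicValNat.mul (hf a (Finset.mem_insert_self a s))
        (Finset.prod_ne_zero_iff.mpr fun i hi ↦ hf i (Finset.mem_insert_of_mem hi)),
      ih fun i hi ↦ hf i (Finset.mem_insert_of_mem hi)]

/-- **(eq:tamK), twist half, at EVERY odd prime: `ord_p ∏_ℓ c_ℓ(E^{(d_K)}) = ord_p ∏_ℓ c_ℓ(E)`** for
`p ≠ 2`, `K` imaginary quadratic with `d_K` odd satisfying the Heegner hypothesis for the conductor of
the globally minimal `W`, and ANY equation `Wd = Cd • W^{(d_K)}` of the twist — NO hypothesis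
`p ∤ d_K` (the tree's `X2.padicValNat_tamagawaProduct_twist_of_heegner_of_odd` has it). Both
products are finite products of `ℓ`-adic local Tamagawa numbers over the union of the bad places
(`tamagawaProduct_eq_prod`), compared prime by prime by
`padicValNat_localTamagawaNumber_twist_eq_of_heegner_odd`.
[cite: JetchevSkinnerWan2017, §7.3.1 (eq:tamK) and §7.4.1 (arXiv:1512.06894 pp. 29–31)]
[cite: SilvermanATAEC1994, Cor. IV.9.2(d) and Table 4.1] -/
theorem padicValNat_tamagawaProduct_twist_eq_of_heegner_odd (W : WeierstrassCurve ℚ) [W.IsElliptic]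
    [W.IsGloballyMinimal] (p : ℕ) [Fact p.Prime] (hp2 : p ≠ 2) (K : Type) [Field K] [NumberField K]
    (hK : IsImaginaryQuadratic K) (hodd : Odd (NumberField.discr K))
    (hH : SatisfiesHeegnerHypothesis (W.conductorNorm ℤ) K)
    {Wd : WeierstrassCurve ℚ} [Wd.IsElliptic] (Cd : VariableChange ℚ)
    (hWd : Cd • W.quadraticTwist (NumberField.discr K : ℚ) = Wd) :
    padicValNat p Wd.tamagawaProduct = padicValNat p W.tamagawaProduct := by
  have hfW : (W.badPlaces ℤ).Finite := W.finite_badPlaces_holds ℤ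
  have hfWd : (Wd.badPlaces ℤ).Finite := Wd.finite_badPlaces_holds ℤ
  set s : Finset (IsDedekindDomain.HeightOneSpectrum ℤ) := hfW.toFinset ∪ hfWd.toFinset with hs
  have hsW : ∀ v, ¬ W.HasGoodReductionAt v → v ∈ s := fun v hv ↦
    Finset.mem_union_left _ (by rw [Set.Finite.mem_toFinset, mem_badPlaces_iff]; exact hv)
  have hsWd : ∀ v, ¬ Wd.HasGoodReductionAt v → v ∈ s := fun v hv ↦
    Finset.mem_union_right _ (by rw [Set.Finite.mem_toFinset, mem_badPlaces_iff]; exact hv)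
  rw [tamagawaProduct_eq_prod W s hsW, tamagawaProduct_eq_prod Wd s hsWd,
    padicValNat_finset_prod_stubs p s _ fun v _ ↦ ?_, padicValNat_finset_prod_stubs p s _ fun v _ ↦ ?_]
  · refine Finset.sum_congr rfl fun v _ ↦ ?_
    haveI := Fact.mk (primesEquiv v).2
    exact padicValNat_localTamagawaNumber_twist_eq_of_heegner_odd W p hp2 K hK hodd hH Cd hWd
      (primesEquiv v)
  · haveI := Fact.mk (primesEquiv v).2
    haveI : (Wd.baseChange ℚ_[primesEquiv v]).IsElliptic :=
      inferInstanceAs (Wd.map (algebraMap ℚ ℚ_[primesEquiv v])).IsElliptic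
    exact localTamagawaNumber_padic_ne_zero_holds (primesEquiv v) _
  · haveI := Fact.mk (primesEquiv v).2
    haveI : (W.baseChange ℚ_[primesEquiv v]).IsElliptic :=
      inferInstanceAs (W.map (algebraMap ℚ ℚ_[primesEquiv v])).IsElliptic
    exact localTamagawaNumber_padic_ne_zero_holds (primesEquiv v) _

/-! ### §2 `v_p(u) = 0` for the minimal model of the twist, every odd `p` -/

/-- **`v_p(u(Cd)) = 0` at a GOOD odd prime `p` with `p² ∤ d`**, for `W/ℚ` globally minimal, `d ∈ ℤ`,
`d ≠ 0`, and a globally minimal model `Wd = Cd • W^{(d)}` of the twist: `Δ(Wd) = u⁻¹²·d⁶·Δ(W)`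
(`variableChange_Δ`, `quadraticTwist_Δ`) with `v_p Δ(W) = v_p Δ_min(E) = 0` (good reduction,
`not_dvd_minimalDiscriminantInt_of_hasGoodReductionAtPrime`), `v_p Δ(Wd) ≥ 0` (integral model) and
`v_p(d) ≤ 1`, so `12·v_p(u) ≤ 6`; and `0 ≤ v_p(u)` (`padicValRat_u_nonneg_of_twist_minimal_of_odd`).
(At `p ∣ d` the twist is of type `I₀*` with `v_p Δ = 6 < 12`, so its equation is already minimal.)
[cite: SilvermanAEC2009, VII.1 Prop. 1.3 and Remark 1.1 (v(Δ) < 12 ⇒ minimal)] [cite: SilvermanAEC2009, X.5 Cor. 5.4] -/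
theorem padicValRat_u_eq_zero_of_twist_minimal_of_good_of_odd (W : WeierstrassCurve ℚ) [W.IsElliptic]
    [W.IsGloballyMinimal] (p : ℕ) [Fact p.Prime] (hp2 : p ≠ 2) (hgood : W.HasGoodReductionAtPrime p)
    (d : ℤ) (hd : d ≠ 0) (hd2 : ¬ (p : ℤ) ^ 2 ∣ d)
    {Wd : WeierstrassCurve ℚ} [Wd.IsElliptic] [Wd.IsGloballyMinimal] (Cd : VariableChange ℚ)
    (hWd : Cd • W.quadraticTwist (d : ℚ) = Wd) :
    padicValRat p (Cd.u : ℚ) = 0 := by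
  have hu0 : 0 ≤ padicValRat p (Cd.u : ℚ) :=
    padicValRat_u_nonneg_of_twist_minimal_of_odd W p hp2 d hd Cd hWd
  have hD0 : (d : ℚ) ≠ 0 := by exact_mod_cast hd
  have hWΔ : W.Δ ≠ 0 := W.isUnit_Δ.ne_zero
  have huq : (Cd.u : ℚ) ≠ 0 := Cd.u.ne_zero
  -- `Δ(Wd) = u⁻¹² · d⁶ · Δ(W)`
  have hΔ : Wd.Δ = (Cd.u : ℚ)⁻¹ ^ 12 * ((d : ℚ) ^ 6 * W.Δ) := by
    rw [← hWd, variableChange_Δ, quadraticTwist_Δ, Units.val_inv_eq_inv_val]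
  -- `v_p Δ(W) = 0` (good reduction), `0 ≤ v_p Δ(Wd)` (integral model), `v_p d ≤ 1`
  have hvW : padicValRat p W.Δ = 0 := by
    rw [← cast_minimalDiscriminantInt W, padicValRat.of_int,
      padicValInt.eq_zero_of_not_dvd
        (not_dvd_minimalDiscriminantInt_of_hasGoodReductionAtPrime W p hgood),
      Nat.cast_zero]
  have hvWd : 0 ≤ padicValRat p Wd.Δ := by
    rw [← cast_minimalDiscriminantInt Wd, padicValRat.of_int]
    exact Int.natCast_nonneg _
  have hvd : padicValRat p (d : ℚ) ≤ 1 := by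
    rw [padicValRat.of_int]
    have h : ¬ 2 ≤ padicValInt p d := fun h2 ↦ hd2 ((padicValInt_dvd_iff 2 d).mpr (Or.inr h2))
    omega
  rw [hΔ, padicValRat.mul (pow_ne_zero _ (inv_ne_zero huq)) (mul_ne_zero (pow_ne_zero _ hD0) hWΔ),
    padicValRat.pow, padicValRat.inv, padicValRat.mul (pow_ne_zero _ hD0) hWΔ, padicValRat.pow,
    hvW] at hvWd
  push_cast at hvWd
  omega

/-- **`v_p(u(Cd)) = 0` at EVERY odd prime `p` for the minimal model of the Heegner twist**: `W/ℚ`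
globally minimal, `K` imaginary quadratic with `d_K` odd in which every prime of `N_E` splits,
`Wd = Cd • W^{(d_K)}` globally minimal. At `p ∣ N_E`, `p` splits in `K` and the tree's
`X11b.padicValRat_u_eq_zero_of_twist_minimal_of_splitsIn` applies (`d_K ∈ (ℚ_p^×)²`, two
`ℚ_p`-isomorphic minimal equations); at `p ∤ N_E`, `W` is good at `p` and `p² ∤ d_K` (squarefree),
so `padicValRat_u_eq_zero_of_twist_minimal_of_good_of_odd` applies. Gen 0 had only `0 ≤ v_p(u)`.
[cite: SilvermanAEC2009, VII.1 Prop. 1.3(b) and X.5 Cor. 5.4] -/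
theorem padicValRat_u_eq_zero_of_twist_minimal_of_heegner_odd (W : WeierstrassCurve ℚ)
    [W.IsElliptic] [W.IsGloballyMinimal] (p : ℕ) [Fact p.Prime] (hp2 : p ≠ 2) (K : Type) [Field K]
    [NumberField K] (hK : IsImaginaryQuadratic K) (hodd : Odd (NumberField.discr K))
    (hH : SatisfiesHeegnerHypothesis (W.conductorNorm ℤ) K)
    {Wd : WeierstrassCurve ℚ} [Wd.IsElliptic] [Wd.IsGloballyMinimal] (Cd : VariableChange ℚ)
    (hWd : Cd • W.quadraticTwist (NumberField.discr K : ℚ) = Wd) :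
    padicValRat p (Cd.u : ℚ) = 0 := by
  have hp : p.Prime := Fact.out
  by_cases hpN : p ∣ W.conductorNorm ℤ
  · exact X11b.padicValRat_u_eq_zero_of_twist_minimal_of_splitsIn W p K hK.1 (hH p hp hpN) Cd hWd
  · have hgood : W.HasGoodReductionAtPrime p := by
      by_contra h
      exact hpN ((W.dvd_conductorNorm_iff_not_hasGoodReductionAtPrime p).mpr h)
    have hsq : ¬ (p : ℤ) ^ 2 ∣ NumberField.discr K := by
      intro h
      have hsf := squarefree_discr_of_odd hK hodd
      have hunit := hsf (p : ℤ) (by rw [← sq]; exact h)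
      rw [Int.isUnit_iff_natAbs_eq, Int.natAbs_natCast] at hunit
      exact hp.one_lt.ne' hunit
    exact padicValRat_u_eq_zero_of_twist_minimal_of_good_of_odd W p hp2 hgood _
      (NumberField.discr_ne_zero K) hsq Cd hWd

/-! ### §3 The registered stub `stub_tamagawa_twist_heegner_odd` of the BC3 skeleton `a5c1d69e…`, verbatim -/

/-- **STUB 3 of the registered skeleton (`stub_tamagawa_twist_heegner_odd`), PROVED**: (eq:tamK) at
every odd prime — `ord_p ∏_ℓ c_ℓ(E^{d_K}) = ord_p ∏_ℓ c_ℓ(E)` for `K` imaginary quadratic with odd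
`d_K` satisfying the Heegner hypothesis for `N = N_E`, `Wd` any globally minimal model of the twist,
`p ≠ 2`, with NO `p ∤ d_K` (§1 `padicValNat_tamagawaProduct_twist_eq_of_heegner_odd`).
[cite: JetchevSkinnerWan2017, §7.3.1 (eq:tamK)] [cite: SilvermanATAEC1994, Cor. IV.9.2(d), Table 4.1] -/
theorem stub_tamagawa_twist_heegner_odd :
    ∀ (W : WeierstrassCurve ℚ) [W.IsElliptic] [W.IsGloballyMinimal] (p : ℕ) [Fact p.Prime]
      (N : ℕ) (K : Type) [Field K] [NumberField K] (Wd : WeierstrassCurve ℚ) [Wd.IsElliptic]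
      [Wd.IsGloballyMinimal],
      W.conductorNorm ℤ = N → IsImaginaryQuadratic K → Odd (NumberField.discr K) →
      SatisfiesHeegnerHypothesis N K →
      (∃ C : VariableChange ℚ, C • W.quadraticTwist (NumberField.discr K : ℚ) = Wd) → p ≠ 2 →
      padicValNat p Wd.tamagawaProduct = padicValNat p W.tamagawaProduct := by
  intro W _ _ p _ N K _ _ Wd _ _ hN hK hodd hH hWd hp2
  obtain ⟨Cd, hCd⟩ := hWd
  exact padicValNat_tamagawaProduct_twist_eq_of_heegner_odd W p hp2 K hK hodd (hN ▸ hH) Cd hCd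

end Summit.BirchSwinnertonDyer.BirchSwinnertonDyer.Theorems.SchneiderFree

end
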